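import Mathlib
import HarnessLib
import Summits.HubbardSuperconductivity.HubbardSuperconductivity.Theorems.KLProgrammeKLRegimeTwoVolumeSpectatorLegs

/-!
# Route `KLProgramme` — crux K3, VL child `KLRegimeVolumeLimitV17F2` (stmt-HubbardSuperconductivity-20440), located risk #8 / token #24 as a THEOREM
# ((α′), plan (R59an)): THE SOURCE-GRADED SINGLE-SCALE STEP WITHOUT SMALLNESS OF THE SOURCE SECTOR
# (cell gate-hubbard-kl, seat hubbard-kl-k3c5-p3 g10, technique «OS-positivity-free direct assembly»)

The one-volume induction that produces the source-sector profiles (BGM 2006 §2.9 «repeating the proof of (2.52a)», the B-sector pass) needs, at each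
scale, a bound on the kernels of `effAction C′ (A₀ + B)` on strings with one or two SOURCE legs — `A₀` the in-band action (copy `0`, small:
`θ₀ = eα‖A₀‖_h/κ² < 1`), `B` the source sector (every kernel carries a source leg; NOT small), `C′` the spectator covariance of `…TwoVolumeSpectatorLegs`
(zero on the source copy).  The cumulant series of `A₀ + B` need not converge in the ungraded norm, but the SOURCE RESCALING `S_c` (`c` on copy `1`, `1` on
copy `0`) commutes with the step EXACTLY (`effAction_spectator_rescale`), multiplies a kernel with `d` source legs by `c^d` (`kernel_map_mulLeft`), fixes `A₀`,
and shrinks the source profile by `c` (`‖S_c B‖_h ≤ c‖B‖_h`); for `c` small the tree's Lipschitz step applies to `A₀ + S_c B` and the `c`-powers are undone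
on the low-source strings:

* **`sum_norm_kernel_effAction_lowSource_le`** — for every `0 < c ≤ 1` with `θ_c = eα(‖A₀‖_h + c‖B‖_h)/κ² < 1`, every degree `m ≥ 1`, pin `(i, w)` and source
  bound `d`:  `Σ_{W : W_i = w, 1 ≤ #src W ≤ d} ‖kernel_m (effAction C′ (A₀ + B)) (W)‖ ≤ (c^d)⁻¹ · ρ^{−m} · e·c‖B‖_h / (1 − θ_c)²`
  — with `c ≍ κ²(1−θ₀)/(2eα‖B‖_h)` this is QUADRATIC in `‖B‖_h` for `d = 2` with constants from the in-band smallness ONLY (no radius floor for the source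
  legs, no smallness of the source sector: what the rate-free VL induction over `j ≤ n⋆` needs, VL-OBSERVABLE-SECTOR-g10 §3 (α′));
* `isUnit_effPartitionFn_add_source` — the partition function of `A₀ + B` is that of `A₀ + S_c B` (sources are dead variables), hence a unit;
* tools: `norm_prod_sourceWeight` (`‖Π_i c(W_i)‖ = c^{#src W}`), `sum_norm_kernel_sourceRescale_le` (profile of `S_c B ≤ c·`profile of `B`),
  `sourceRescale_copyZero` (`S_c A₀ = A₀`), `transpose_mul_spectatorCov_mul_sourceWeight` (`S_cᵀ C′ S_c = C′`).

SHARPNESS: the linear-in-`‖B‖_h` term carries one `c⁻¹`; the sharp constants (no `c⁻¹`) follow from the species-graded cumulant bound (k3c5-p2,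
`…CumulantSpeciesGradedDB`, tonight) + the source grading (`srcGE`, k3c4-p1) — not needed for the rate-free statement.  Proofs only; no definition; generic
(`RCLike 𝕜`, labels `Γ × Fin 2`).  References: BGM 2006 §2.9, (2.13)–(2.14), (2.86)–(2.90); Gawȩdzki–Kupiainen 1985 §3.
-/

noncomputable section

namespace Summit.HubbardSuperconductivity.HubbardSuperconductivity.Theorems.TwoVolumeDefect

set_option linter.dupNamespace false -- summit = problem name (single-conjunct summit), D-0017

open Finset Literature.MathematicalPhysics.QuantumLattice GrassmannAlgebra Literature.Probability.LatticeModels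
open scoped Nat

universe u

/-! ## §1 The source weight `c` (copy `1`) / `1` (copy `0`) -/

section Weight

variable {𝕜 : Type*} [RCLike 𝕜] {Γ : Type*}

/-- **`‖Π_i c(W_i)‖ = c^{#src W}`** for the source weight (`1` on copy `0`, `c ≥ 0` on copy `1`). [folklore] -/
theorem norm_prod_sourceWeight {c : ℝ} (hc : 0 ≤ c) (cw : Γ × Fin 2 → 𝕜) (hcw : ∀ p, cw p = if p.2 = 0 then 1 else (c : 𝕜))
    {m : ℕ} (W : Fin m → Γ × Fin 2) :
    ‖∏ i, cw (W i)‖ = c ^ (univ.filter (fun i => (W i).2 = 1)).card := by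
  classical
  rw [norm_prod, ← prod_filter_mul_prod_filter_not univ (fun i => (W i).2 = 1)]
  have h1 : ∏ i ∈ univ.filter (fun i => (W i).2 = 1), ‖cw (W i)‖ = c ^ (univ.filter (fun i => (W i).2 = 1)).card := by
    rw [prod_congr rfl (fun i hi => show ‖cw (W i)‖ = c from ?_), prod_const]
    have hi' : (W i).2 = 1 := (mem_filter.1 hi).2
    rw [hcw, if_neg (by rw [hi']; decide), RCLike.norm_ofReal, abs_of_nonneg hc]
  have h0 : ∏ i ∈ univ.filter (fun i => ¬ (W i).2 = 1), ‖cw (W i)‖ = 1 := by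
    refine prod_eq_one fun i hi => ?_
    have hi' : (W i).2 = 0 := by
      have := (mem_filter.1 hi).2
      rcases Fin.exists_fin_two.1 ⟨(W i).2, rfl⟩ with h | h
      · exact h
      · exact absurd h this
    rw [hcw, if_pos hi', norm_one]
  rw [h1, h0, mul_one]

/-- `c^{#src W} ≤ c` when the string has at least one source leg and `0 ≤ c ≤ 1`. [folklore] -/
theorem pow_card_src_le {c : ℝ} (hc0 : 0 ≤ c) (hc1 : c ≤ 1) {m : ℕ} (W : Fin m → Γ × Fin 2) (h : ∃ j, (W j).2 = 1) :
    c ^ (univ.filter (fun i => (W i).2 = 1)).card ≤ c := by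
  classical
  obtain ⟨j, hj⟩ := h
  have hcard : 1 ≤ (univ.filter (fun i => (W i).2 = 1)).card := card_pos.2 ⟨j, mem_filter.2 ⟨mem_univ _, hj⟩⟩
  calc c ^ (univ.filter (fun i => (W i).2 = 1)).card ≤ c ^ 1 := pow_le_pow_of_le_one hc0 hc1 hcard
    _ = c := pow_one c

/-- `c^d ≤ c^{#src W}` when `#src W ≤ d` and `0 ≤ c ≤ 1`. [folklore] -/
theorem pow_le_pow_card_src {c : ℝ} (hc0 : 0 ≤ c) (hc1 : c ≤ 1) {m d : ℕ} (W : Fin m → Γ × Fin 2)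
    (h : (univ.filter (fun i => (W i).2 = 1)).card ≤ d) : c ^ d ≤ c ^ (univ.filter (fun i => (W i).2 = 1)).card :=
  pow_le_pow_of_le_one hc0 hc1 h

end Weight

/-! ## §2 Source rescaling: profiles, the copy-`0` part, the covariance -/

section Rescale

variable {𝕜 : Type*} [RCLike 𝕜] {Γ : Type*} [Fintype Γ] [DecidableEq Γ]

omit [Fintype Γ] [DecidableEq Γ] in
/-- **The profile of `S_c B` is `≤ c ×` the profile of `B`** when every kernel of `B` carries a source leg (`0 ≤ c ≤ 1`). [folklore] -/
theorem sum_norm_kernel_sourceRescale_le {c : ℝ} (hc0 : 0 ≤ c) (hc1 : c ≤ 1) (cw : Γ × Fin 2 → 𝕜)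
    (hcw : ∀ p, cw p = if p.2 = 0 then 1 else (c : 𝕜)) (B : GrassmannAlgebra 𝕜 (Γ × Fin 2))
    (hBsrc : ∀ (m : ℕ) (W : Fin m → Γ × Fin 2), kernel 𝕜 B m W ≠ 0 → ∃ j, (W j).2 = 1)
    {m : ℕ} (S : Finset (Fin m → Γ × Fin 2)) {N : ℝ} (hN : ∑ W ∈ S, ‖kernel 𝕜 B m W‖ ≤ N) :
    ∑ W ∈ S, ‖kernel 𝕜 (ExteriorAlgebra.map (LinearMap.mulLeft 𝕜 cw) B) m W‖ ≤ c * N := by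
  calc ∑ W ∈ S, ‖kernel 𝕜 (ExteriorAlgebra.map (LinearMap.mulLeft 𝕜 cw) B) m W‖
      ≤ ∑ W ∈ S, c * ‖kernel 𝕜 B m W‖ := by
        refine sum_le_sum fun W _ => ?_
        rw [kernel_map_mulLeft, norm_mul, norm_prod_sourceWeight hc0 cw hcw W]
        by_cases hk : kernel 𝕜 B m W = 0
        · rw [hk, norm_zero, mul_zero, mul_zero]
        · exact mul_le_mul_of_nonneg_right (pow_card_src_le hc0 hc1 W (hBsrc m W hk)) (norm_nonneg _)
    _ = c * ∑ W ∈ S, ‖kernel 𝕜 B m W‖ := by rw [mul_sum]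
    _ ≤ c * N := mul_le_mul_of_nonneg_left hN hc0

omit [Fintype Γ] [DecidableEq Γ] in
/-- **Source rescaling fixes the copy-`0` part**: `S_c (S_{𝟙₀} Y) = S_{𝟙₀} Y`. [folklore] -/
theorem sourceRescale_copyZero (cw c₀ : Γ × Fin 2 → 𝕜) (hcw0 : ∀ p : Γ × Fin 2, p.2 = 0 → cw p = 1)
    (hc₀ : ∀ p : Γ × Fin 2, c₀ p = if p.2 = 0 then 1 else 0) (Y : GrassmannAlgebra 𝕜 (Γ × Fin 2)) :
    ExteriorAlgebra.map (LinearMap.mulLeft 𝕜 cw) (ExteriorAlgebra.map (LinearMap.mulLeft 𝕜 c₀) Y) =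
      ExteriorAlgebra.map (LinearMap.mulLeft 𝕜 c₀) Y := by
  have hprod : cw * c₀ = c₀ := by
    funext p
    rw [Pi.mul_apply, hc₀]
    split_ifs with h
    · rw [hcw0 p h, mul_one]
    · rw [mul_zero]
  rw [map_mulLeft_map_mulLeft, hprod]

omit [Fintype Γ] [DecidableEq Γ] in
/-- **`S_cᵀ C′ S_c = C′`**: the source weight does not touch the spectator covariance. [folklore] -/
theorem diagonal_sourceWeight_spectatorCov (C : Matrix Γ Γ 𝕜) (C' : Matrix (Γ × Fin 2) (Γ × Fin 2) 𝕜)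
    (hC' : ∀ p q, C' p q = if p.2 = 0 ∧ q.2 = 0 then C p.1 q.1 else 0) (cw : Γ × Fin 2 → 𝕜)
    (hcw0 : ∀ p : Γ × Fin 2, p.2 = 0 → cw p = 1) :
    (Matrix.of fun p q => cw p * cw q * C' p q) = C' := by
  ext p q
  rw [Matrix.of_apply, hC']
  split_ifs with h
  · rw [hcw0 p h.1, hcw0 q h.2, one_mul, one_mul]
  · rw [mul_zero]

/-- **The partition function does not see the source rescaling**: `Z(C′, S_c W) = Z(C′, W)`. [folklore] -/
theorem effPartitionFn_sourceRescale (C : Matrix Γ Γ 𝕜) (C' : Matrix (Γ × Fin 2) (Γ × Fin 2) 𝕜)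
    (hC' : ∀ p q, C' p q = if p.2 = 0 ∧ q.2 = 0 then C p.1 q.1 else 0) (cw : Γ × Fin 2 → 𝕜)
    (hcw0 : ∀ p : Γ × Fin 2, p.2 = 0 → cw p = 1) (W : GrassmannAlgebra 𝕜 (Γ × Fin 2)) :
    effPartitionFn 𝕜 C' (ExteriorAlgebra.map (LinearMap.mulLeft 𝕜 cw) W) = effPartitionFn 𝕜 C' W := by
  rw [effPartitionFn_map, toMatrix'_mulLeft, diagonal_transpose_mul_mul_diagonal, diagonal_sourceWeight_spectatorCov C C' hC' cw hcw0]

end Rescale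

/-! ## §3 The source-graded step -/

section Graded

variable {𝕜 : Type*} [RCLike 𝕜] {Γ : Type u} [Fintype Γ] [DecidableEq Γ]
  (C : Matrix Γ Γ 𝕜) (C' : Matrix (Γ × Fin 2) (Γ × Fin 2) 𝕜)
  (hC' : ∀ p q, C' p q = if p.2 = 0 ∧ q.2 = 0 then C p.1 q.1 else 0)
include hC'

/-- **THE SOURCE-GRADED SINGLE-SCALE STEP — NO SMALLNESS OF THE SOURCE SECTOR.**  `C` replica-Gram-bounded (`κ`) with row/column sums `≤ α`, `C′` its
spectator covariance; `A₀ = S_{𝟙₀} Y` (copy `0`, even, no constant part, profile `N₀`); `B` even, no constant part, profile `N_B`, EVERY kernel of `B`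
carrying a source leg; a source weight `0 < c ≤ 1` with `θ_c = eα(‖A₀‖_h + c‖B‖_h)/κ² < 1`.  Then for every degree `m ≥ 1`, pin `(i,w)` and `d ≥ 1`:
`Σ_{W : W_i = w, 1 ≤ #src W ≤ d} ‖kernel_m (effAction C′ (A₀ + B)) (W)‖ ≤ (c^d)⁻¹ · ρ^{−m} · e·‖S_cB‖_h / (1 − θ_c)²` (`‖S_cB‖_h = c‖B‖_h`, so the
right side is `c^{1−d}·ρ^{−m}e‖B‖_h/(1−θ_c)²`). [cite: BenfattoGiulianiMastropietro2006, §2.9 and (2.86)-(2.90)] -/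
theorem sum_norm_kernel_effAction_lowSource_le {κ : ℝ} (hκ : 0 < κ) (hGB : IsGramBoundedR C κ)
    (c₀ : Γ × Fin 2 → 𝕜) (hc₀ : ∀ p : Γ × Fin 2, c₀ p = if p.2 = 0 then 1 else 0)
    (Y B : GrassmannAlgebra 𝕜 (Γ × Fin 2)) (hA₀ : ExteriorAlgebra.map (LinearMap.mulLeft 𝕜 c₀) Y ∈ evenPart 𝕜 (Γ × Fin 2))
    (hB : B ∈ evenPart 𝕜 (Γ × Fin 2)) (hA₀0 : constPart 𝕜 (ExteriorAlgebra.map (LinearMap.mulLeft 𝕜 c₀) Y) = 0) (hB0 : constPart 𝕜 B = 0)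
    (hBsrc : ∀ (m : ℕ) (W : Fin m → Γ × Fin 2), kernel 𝕜 B m W ≠ 0 → ∃ j, (W j).2 = 1)
    (N₀ NB : ℕ → ℝ) (hN₀0 : ∀ m', 0 ≤ N₀ m') (hNB0 : ∀ m', 0 ≤ NB m')
    (hN₀ : ∀ m' (j : Fin (2 * m')) (w : Γ × Fin 2), ∑ W ∈ univ.filter (fun W : Fin (2 * m') → Γ × Fin 2 => W j = w),
      ‖kernel 𝕜 (ExteriorAlgebra.map (LinearMap.mulLeft 𝕜 c₀) Y) (2 * m') W‖ ≤ N₀ m')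
    (hNB : ∀ m' (j : Fin (2 * m')) (w : Γ × Fin 2), ∑ W ∈ univ.filter (fun W : Fin (2 * m') → Γ × Fin 2 => W j = w),
      ‖kernel 𝕜 B (2 * m') W‖ ≤ NB m')
    {α : ℝ} (hα : 0 < α) (hrow : ∀ X, ∑ Y, ‖C X Y‖ ≤ α) (hcol : ∀ Y, ∑ X, ‖C X Y‖ ≤ α) {ρ : ℝ} (hρ : 0 < ρ)
    {c : ℝ} (hc0 : 0 < c) (hc1 : c ≤ 1)
    (hθ : Real.exp 1 * α * (normV (Γ × Fin 2) κ ρ N₀ + normV (Γ × Fin 2) κ ρ (fun m' => c * NB m')) / κ ^ 2 < 1)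
    {m : ℕ} (hm : 0 < m) (i : Fin m) (w : Γ × Fin 2) (d : ℕ) :
    ∑ W ∈ univ.filter (fun W : Fin m → Γ × Fin 2 =>
        W i = w ∧ 1 ≤ (univ.filter (fun j => (W j).2 = 1)).card ∧ (univ.filter (fun j => (W j).2 = 1)).card ≤ d),
        ‖kernel 𝕜 (effAction 𝕜 C' (ExteriorAlgebra.map (LinearMap.mulLeft 𝕜 c₀) Y + B)) m W‖ ≤
      (c ^ d)⁻¹ * (ρ⁻¹ ^ m * (Real.exp 1 * normV (Γ × Fin 2) κ ρ (fun m' => c * NB m')) /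
        (1 - Real.exp 1 * α * (normV (Γ × Fin 2) κ ρ N₀ + normV (Γ × Fin 2) κ ρ (fun m' => c * NB m')) / κ ^ 2) ^ 2) := by
  classical
  -- the source weight
  set cw : Γ × Fin 2 → 𝕜 := fun p => if p.2 = 0 then 1 else (c : 𝕜) with hcwdef
  have hcw : ∀ p, cw p = if p.2 = 0 then 1 else (c : 𝕜) := fun p => rfl
  have hcw0 : ∀ p : Γ × Fin 2, p.2 = 0 → cw p = 1 := fun p hp => by rw [hcw, if_pos hp]
  set A₀ := ExteriorAlgebra.map (LinearMap.mulLeft 𝕜 c₀) Y with hA₀def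
  set Bc := ExteriorAlgebra.map (LinearMap.mulLeft 𝕜 cw) B with hBcdef
  -- the rescaled source sector: even, no constant part, profile `c · N_B`
  have hBce : Bc ∈ evenPart 𝕜 (Γ × Fin 2) := (mem_evenPart_iff).2 (map_mem_evenOdd_zero 𝕜 (LinearMap.mulLeft 𝕜 cw) ((mem_evenPart_iff).1 hB))
  have hBc0 : constPart 𝕜 Bc = 0 := by rw [hBcdef, constPart_map, hB0]
  have hNBc : ∀ m' (j : Fin (2 * m')) (w : Γ × Fin 2), ∑ W ∈ univ.filter (fun W : Fin (2 * m') → Γ × Fin 2 => W j = w),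
      ‖kernel 𝕜 Bc (2 * m') W‖ ≤ c * NB m' :=
    fun m' j w => sum_norm_kernel_sourceRescale_le hc0.le hc1 cw hcw B hBsrc _ (hNB m' j w)
  -- the graded Lipschitz step of `…SpectatorLegs` for `A₀ + S_c B`, on strings with a source leg
  have hstep := sum_norm_kernel_effAction_spectator_le_of_exists_leg C C' hC' hκ hGB c₀ hc₀ Y Bc hA₀ hBce hA₀0 hBc0 N₀ (fun m' => c * NB m')
    hN₀0 (fun m' => mul_nonneg hc0.le (hNB0 m')) hN₀ hNBc hα hrow hcol hρ hθ hm i w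
  -- `A₀ + S_c B = S_c (A₀ + B)` and the step commutes with `S_c`
  have hresc : A₀ + Bc = ExteriorAlgebra.map (LinearMap.mulLeft 𝕜 cw) (A₀ + B) := by
    rw [map_add, hA₀def, sourceRescale_copyZero cw c₀ hcw0 hc₀ Y]
  have hflow : effAction 𝕜 C' (A₀ + Bc) = ExteriorAlgebra.map (LinearMap.mulLeft 𝕜 cw) (effAction 𝕜 C' (A₀ + B)) := by
    rw [hresc, effAction_spectator_rescale C C' hC' cw hcw0]
  -- kernels: `kernel (effAction C′ (A₀ + S_c B)) m W = c^{#src W} · kernel (effAction C′ (A₀ + B)) m W`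
  have hker : ∀ W : Fin m → Γ × Fin 2, ‖kernel 𝕜 (effAction 𝕜 C' (A₀ + Bc)) m W‖ =
      c ^ (univ.filter (fun j => (W j).2 = 1)).card * ‖kernel 𝕜 (effAction 𝕜 C' (A₀ + B)) m W‖ := by
    intro W
    rw [hflow, kernel_map_mulLeft, norm_mul, norm_prod_sourceWeight hc0.le cw hcw W]
  -- restrict the step's sum to the low-source strings and undo the weights
  set S := univ.filter (fun W : Fin m → Γ × Fin 2 =>
    W i = w ∧ 1 ≤ (univ.filter (fun j => (W j).2 = 1)).card ∧ (univ.filter (fun j => (W j).2 = 1)).card ≤ d) with hS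
  have hsub : S ⊆ univ.filter (fun W : Fin m → Γ × Fin 2 => W i = w ∧ ∃ j, (W j).2 = 1) := by
    intro W hW
    obtain ⟨hWi, h1, -⟩ := (mem_filter.1 hW).2
    obtain ⟨j, hj⟩ := card_pos.1 h1
    exact mem_filter.2 ⟨mem_univ _, hWi, j, (mem_filter.1 hj).2⟩
  have hcd : 0 < c ^ d := pow_pos hc0 d
  have hmain : c ^ d * ∑ W ∈ S, ‖kernel 𝕜 (effAction 𝕜 C' (A₀ + B)) m W‖ ≤
      ρ⁻¹ ^ m * (Real.exp 1 * normV (Γ × Fin 2) κ ρ (fun m' => c * NB m')) /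
        (1 - Real.exp 1 * α * (normV (Γ × Fin 2) κ ρ N₀ + normV (Γ × Fin 2) κ ρ (fun m' => c * NB m')) / κ ^ 2) ^ 2 := by
    calc c ^ d * ∑ W ∈ S, ‖kernel 𝕜 (effAction 𝕜 C' (A₀ + B)) m W‖
        = ∑ W ∈ S, c ^ d * ‖kernel 𝕜 (effAction 𝕜 C' (A₀ + B)) m W‖ := by rw [mul_sum]
      _ ≤ ∑ W ∈ S, ‖kernel 𝕜 (effAction 𝕜 C' (A₀ + Bc)) m W‖ := by
          refine sum_le_sum fun W hW => ?_
          rw [hker W]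
          exact mul_le_mul_of_nonneg_right (pow_le_pow_card_src hc0.le hc1 W (mem_filter.1 hW).2.2.2) (norm_nonneg _)
      _ ≤ ∑ W ∈ univ.filter (fun W : Fin m → Γ × Fin 2 => W i = w ∧ ∃ j, (W j).2 = 1), ‖kernel 𝕜 (effAction 𝕜 C' (A₀ + Bc)) m W‖ :=
          sum_le_sum_of_subset_of_nonneg hsub fun _ _ _ => norm_nonneg _
      _ ≤ _ := hstep
  -- divide by `c^d`
  calc ∑ W ∈ S, ‖kernel 𝕜 (effAction 𝕜 C' (A₀ + B)) m W‖
      = (c ^ d)⁻¹ * (c ^ d * ∑ W ∈ S, ‖kernel 𝕜 (effAction 𝕜 C' (A₀ + B)) m W‖) := by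
        rw [← mul_assoc, inv_mul_cancel₀ hcd.ne', one_mul]
    _ ≤ _ := mul_le_mul_of_nonneg_left hmain (inv_nonneg.2 hcd.le)

/-- **The partition function of `A₀ + B` is a unit** (no smallness of `B`): `Z(C′, A₀ + B) = Z(C′, S_c(A₀ + B)) = Z(C′, A₀ + S_c B)` (sources are dead
variables), and the latter is a unit under `θ_c < 1`. [cite: BenfattoGiulianiMastropietro2006, (2.13)-(2.14)] -/
theorem isUnit_effPartitionFn_add_source {κ : ℝ} (hκ : 0 < κ) (hGB : IsGramBoundedR C κ)
    (c₀ : Γ × Fin 2 → 𝕜) (hc₀ : ∀ p : Γ × Fin 2, c₀ p = if p.2 = 0 then 1 else 0)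
    (Y B : GrassmannAlgebra 𝕜 (Γ × Fin 2)) (hA₀ : ExteriorAlgebra.map (LinearMap.mulLeft 𝕜 c₀) Y ∈ evenPart 𝕜 (Γ × Fin 2))
    (hB : B ∈ evenPart 𝕜 (Γ × Fin 2)) (hA₀0 : constPart 𝕜 (ExteriorAlgebra.map (LinearMap.mulLeft 𝕜 c₀) Y) = 0) (hB0 : constPart 𝕜 B = 0)
    (hBsrc : ∀ (m : ℕ) (W : Fin m → Γ × Fin 2), kernel 𝕜 B m W ≠ 0 → ∃ j, (W j).2 = 1)
    (N₀ NB : ℕ → ℝ) (hN₀0 : ∀ m', 0 ≤ N₀ m') (hNB0 : ∀ m', 0 ≤ NB m')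
    (hN₀ : ∀ m' (j : Fin (2 * m')) (w : Γ × Fin 2), ∑ W ∈ univ.filter (fun W : Fin (2 * m') → Γ × Fin 2 => W j = w),
      ‖kernel 𝕜 (ExteriorAlgebra.map (LinearMap.mulLeft 𝕜 c₀) Y) (2 * m') W‖ ≤ N₀ m')
    (hNB : ∀ m' (j : Fin (2 * m')) (w : Γ × Fin 2), ∑ W ∈ univ.filter (fun W : Fin (2 * m') → Γ × Fin 2 => W j = w),
      ‖kernel 𝕜 B (2 * m') W‖ ≤ NB m')
    {α : ℝ} (hα : 0 < α) (hrow : ∀ X, ∑ Y, ‖C X Y‖ ≤ α) (hcol : ∀ Y, ∑ X, ‖C X Y‖ ≤ α) {ρ : ℝ} (hρ : 0 < ρ)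
    {c : ℝ} (hc0 : 0 < c) (hc1 : c ≤ 1)
    (hθ : Real.exp 1 * α * (normV (Γ × Fin 2) κ ρ N₀ + normV (Γ × Fin 2) κ ρ (fun m' => c * NB m')) / κ ^ 2 < 1) :
    IsUnit (effPartitionFn 𝕜 C' (ExteriorAlgebra.map (LinearMap.mulLeft 𝕜 c₀) Y + B)) := by
  classical
  set cw : Γ × Fin 2 → 𝕜 := fun p => if p.2 = 0 then 1 else (c : 𝕜) with hcwdef
  have hcw : ∀ p, cw p = if p.2 = 0 then 1 else (c : 𝕜) := fun p => rfl
  have hcw0 : ∀ p : Γ × Fin 2, p.2 = 0 → cw p = 1 := fun p hp => by rw [hcw, if_pos hp]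
  set Bc := ExteriorAlgebra.map (LinearMap.mulLeft 𝕜 cw) B with hBcdef
  have hBce : Bc ∈ evenPart 𝕜 (Γ × Fin 2) := (mem_evenPart_iff).2 (map_mem_evenOdd_zero 𝕜 (LinearMap.mulLeft 𝕜 cw) ((mem_evenPart_iff).1 hB))
  have hBc0 : constPart 𝕜 Bc = 0 := by rw [hBcdef, constPart_map, hB0]
  have hNBc : ∀ m' (j : Fin (2 * m')) (w : Γ × Fin 2), ∑ W ∈ univ.filter (fun W : Fin (2 * m') → Γ × Fin 2 => W j = w),
      ‖kernel 𝕜 Bc (2 * m') W‖ ≤ c * NB m' :=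
    fun m' j w => sum_norm_kernel_sourceRescale_le hc0.le hc1 cw hcw B hBsrc _ (hNB m' j w)
  obtain ⟨-, hZ, -⟩ := sum_norm_kernel_effAction_spectator_le C C' hC' hκ hGB c₀ hc₀ Y Bc hA₀ hBce hA₀0 hBc0 N₀ (fun m' => c * NB m')
    hN₀0 (fun m' => mul_nonneg hc0.le (hNB0 m')) hN₀ hNBc hα hrow hcol hρ hθ
  have hresc : ExteriorAlgebra.map (LinearMap.mulLeft 𝕜 c₀) Y + Bc =
      ExteriorAlgebra.map (LinearMap.mulLeft 𝕜 cw) (ExteriorAlgebra.map (LinearMap.mulLeft 𝕜 c₀) Y + B) := by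
    rw [map_add, sourceRescale_copyZero cw c₀ hcw0 hc₀ Y]
  rwa [hresc, effPartitionFn_sourceRescale C C' hC' cw hcw0] at hZ

end Graded

end Summit.HubbardSuperconductivity.HubbardSuperconductivity.Theorems.TwoVolumeDefect
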